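import Summits.QuantumFields.YangMills.Theorems.BalabanUVNodesN11AFibreDominationOnSupport

/-!
# DAG node N11 — UNIFORM COERCIVITY AT REGULAR BACKGROUNDS FROM POINTWISE POSITIVE DEFINITENESS: the `Reg`-keyed coercivity row of
# `…N11AFibreDominationOnSupport` (§3∕§4 `…_of_coercive_on_regular`) follows from «`quad_j(Λ′)` is, along each A-fibre, a continuous 2-homogeneous form of
# (background, integrated fluctuation variables) that is POSITIVE DEFINITE at every background of a compact set containing the regular ones» — compactness of
# `SU(N)^{bonds}` turns [I]'s pointwise positivity of `𝒬_j(U)` into the uniform constant the 𝐓-step's Gaussian majorant needs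

HEADER — WORK-UNIT METADATA.  Cell `pub-ymgap`, YM-PLAN Track A (HUMAN RULING D-0062 ∕ D-0149), WIDTH SEAT `pub-ymgap-dag-n11-w4` (g2) on NODE n11 [B14]; route
`BalabanUVNodes` rev 25, item K1⁷ `StabilityBAtRecordR13SepCoPH` = stmt-QuantumFields-20542 (helper, `--kind proof --supports 20542 --as helper`, count-neutral).
Sibling of this seat's `…N11AFibreDominationOnSupport` (p595209).  [III] = [Balaban1988Convergent], [I] = [Balaban1987RG1].

WHY THIS FILE.  The support-keyed row asks, per generation, ONE constant `c_j > 0` with `c_j·Σ_{b∈sA_j} ‖A_j(b)‖² ≤ quad_j(Λ_{j+1})(ω)` at every `Reg_j`-background.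
What a definer of the VALUE of `Zh.quad` (node00-def-K0b) can cite from [I] is POINTWISE: for each regular background `U` the fluctuation form `𝒬_j(U)` is positive
definite ((2.11) p.267: «defines also a Gaussian measure»), and `U ↦ 𝒬_j(U)` is continuous (a finite composition of inverses of positive operators on a finite
lattice).  The passage pointwise ⇒ uniform is compactness: `SU(N)^{bonds}` is compact, the regular set sits in a compact `K₀` where positivity still holds, the
unit sphere of the finite-dimensional A-fibre is compact, and a positive continuous function on a compact set is bounded below by a positive constant.  This file
is that passage, generic (§1) and at the tree's objects (§2–§3), so that the `Reg`-keyed row is fed from three displayed properties of the VALUE: fibre form,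
continuity + 2-homogeneity, pointwise positive definiteness on `K₀`.

WHAT THIS FILE PROVES (0 `sorry`, 0 `def`; standard axioms).
§1 (generic: `X` topological, `E` a proper real normed space) ★ `exists_pos_forall_mul_norm_sq_le_of_isCompact` — a continuous `f : X × E → ℝ`, 2-homogeneous in
   the second variable and positive on `K × (E ∖ 0)` for a compact `K`, admits `c > 0` with `c‖v‖² ≤ f(x, v)` for all `x ∈ K`, all `v`; `sum_norm_sq_le_card_mul_norm_sq`
   (`Σ_i ‖a i‖² ≤ |ι|·‖a‖²` for the sup norm on a finite product).
§2 (generic 12a″ residual `Z`, one generation) `isCompact_of_isClosed_background` (closed sets of backgrounds are compact: `SU(N)^{bonds}`), ★★ `coercive_on_regular_of_posDef` — the `Reg`-keyed coercivity row of the sibling's §3 from: a compact `K₀ ⊇ Reg`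
   in a background space `X` (reading `π`; e.g. `(ω j).1`), a fibre form `quad_j(Λ′)(ω) = Qf (π ω) (A_j ω|_{sA})`, `Qf` jointly continuous, 2-homogeneous, positive
   definite at every point of `K₀`.
§3 (the v1.7 `CoPH` record, generic `θ`) ★★ `coercive_rows_on_regular_of_posDef` — the per-generation rows `hcoer` of the sibling's ★★★
   `integrable_oldBranch_of_coercive_on_regular` from the same three properties of `(θ.zhAt p s′).quad j (Λ_{j+1}(init s′))`, generation by generation — and the
   one-call face ★★★ `integrable_oldBranch_of_posDef_on_compact` (the sibling's §4 with its `Reg`-rows so discharged).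

HONEST FRAMING.  Helper lane of K1⁷; elementary topology∕bookkeeping; [I]'s positive definiteness of `𝒬_j(U)` and the continuity of `U ↦ 𝒬_j(U)` are
DISPLAYED hypotheses on the VALUE (nothing of [I] asserted); no law of record is edited or posited.  N11 NOT discharged; K1⁷ NOT closed; counts unmoved (typed
28∕28 · discharged 5∕27).  One finite four-torus programme at fixed `ε = L^{−K}`; R4 closes only the conditional finite-𝕋⁴ rung `BalabanLadder.UV` — NOT ℝ⁴,
NOT OS, NOT a mass gap, NOT Clay.  No `sorry`, `axiom`, `def`, `instance`, `notation`.
Sources (SHAPE only): [III] (2.21) p.258, (2.10) p.256; [I] (1.4)–(1.5) pp.260–261, (2.11) p.267.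
-/

noncomputable section

open MeasureTheory
open scoped BigOperators ENNReal NNReal

namespace Summit.QuantumFields.YangMills.Theorems.BalabanUVNodesN11CoerciveOnRegularOfPosDef

open Literature.MathematicalPhysics.QuantumFieldTheory.Balaban1983to89 T4Continuum T4NestedCovariance T4AdjointCovariance Node00 Node00.Tk
open B10Eq42TorusConstraint (bondsIn)
open BalabanUVNodesN11AFibreDominationOnSupport (integrable_oldBranch_of_coercive_on_regular)

/-! ## §1  Generic: pointwise positive definiteness on a compact parameter set is uniform coercivity -/
section Generic

variable {X E : Type*} [TopologicalSpace X] [NormedAddCommGroup E] [NormedSpace ℝ E] [ProperSpace E]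

/-- **★ UNIFORM COERCIVITY FROM POINTWISE POSITIVITY ON A COMPACT SET**: `f : X → E → ℝ` jointly continuous, 2-homogeneous in the vector variable
(`f x (t•v) = t²·f x v`) and positive at `(x, v)` for `x ∈ K`, `v ≠ 0`, with `K` compact and `E` a proper (e.g. finite-dimensional) real normed space, admits ONE
constant `c > 0` with `c·‖v‖² ≤ f x v` for all `x ∈ K` and all `v` (minimum of `f` on the compact `K × unit sphere`, then scaling). [folklore] -/
theorem exists_pos_forall_mul_norm_sq_le_of_isCompact {K : Set X} (hK : IsCompact K) (f : X → E → ℝ)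
    (hf : Continuous fun q : X × E => f q.1 q.2) (hhom : ∀ (x : X) (t : ℝ) (v : E), f x (t • v) = t ^ 2 * f x v)
    (hpos : ∀ x ∈ K, ∀ v : E, v ≠ 0 → 0 < f x v) :
    ∃ c : ℝ, 0 < c ∧ ∀ x ∈ K, ∀ v : E, c * ‖v‖ ^ 2 ≤ f x v := by
  have h0 : ∀ x, f x 0 = 0 := fun x => by
    have h := hhom x 0 0
    rw [zero_smul, zero_pow two_ne_zero, zero_mul] at h
    exact h
  have hnorm : ∀ {v : E}, v ≠ 0 → ‖v‖⁻¹ • v ∈ Metric.sphere (0 : E) 1 := fun {v} hv => by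
    rw [mem_sphere_zero_iff_norm, norm_smul, norm_inv, norm_norm, inv_mul_cancel₀ (norm_ne_zero_iff.2 hv)]
  have hscale : ∀ (x : X) {v : E}, v ≠ 0 → f x v = ‖v‖ ^ 2 * f x (‖v‖⁻¹ • v) := fun x {v} hv => by
    rw [← hhom x ‖v‖ (‖v‖⁻¹ • v), smul_smul, mul_inv_cancel₀ (norm_ne_zero_iff.2 hv), one_smul]
  rcases (K ×ˢ Metric.sphere (0 : E) 1).eq_empty_or_nonempty with hempty | hne
  · refine ⟨1, one_pos, fun x hx v => ?_⟩
    by_cases hv : v = 0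
    · rw [hv, norm_zero, h0]; simp
    · have hmem : (x, ‖v‖⁻¹ • v) ∈ K ×ˢ Metric.sphere (0 : E) 1 := Set.mk_mem_prod hx (hnorm hv)
      rw [hempty] at hmem
      exact absurd hmem (Set.notMem_empty _)
  · obtain ⟨z₀, hz₀, hmin⟩ := (hK.prod (isCompact_sphere (0 : E) 1)).exists_isMinOn hne hf.continuousOn
    have hz₀2 : z₀.2 ≠ 0 := by
      have h1 : ‖z₀.2‖ = 1 := mem_sphere_zero_iff_norm.1 hz₀.2
      intro h
      rw [h, norm_zero] at h1
      exact zero_ne_one h1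
    have hm : 0 < f z₀.1 z₀.2 := hpos z₀.1 hz₀.1 z₀.2 hz₀2
    refine ⟨f z₀.1 z₀.2, hm, fun x hx v => ?_⟩
    by_cases hv : v = 0
    · rw [hv, norm_zero, h0]; simp
    · have h1 : f z₀.1 z₀.2 ≤ f x (‖v‖⁻¹ • v) := isMinOn_iff.1 hmin (x, ‖v‖⁻¹ • v) (Set.mk_mem_prod hx (hnorm hv))
      rw [hscale x hv, mul_comm]
      exact mul_le_mul_of_nonneg_left h1 (sq_nonneg _)

omit [NormedSpace ℝ E] [ProperSpace E] in
/-- `Σ_i ‖a i‖² ≤ |ι|·‖a‖²` for the sup norm on a finite product. [folklore] -/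
theorem sum_norm_sq_le_card_mul_norm_sq {ι : Type*} [Fintype ι] (a : ι → E) :
    ∑ i, ‖a i‖ ^ 2 ≤ (Fintype.card ι : ℝ) * ‖a‖ ^ 2 := by
  calc ∑ i, ‖a i‖ ^ 2 ≤ ∑ _i : ι, ‖a‖ ^ 2 :=
        Finset.sum_le_sum fun i _ => pow_le_pow_left₀ (norm_nonneg _) (norm_le_pi_norm a i) 2
    _ = (Fintype.card ι : ℝ) * ‖a‖ ^ 2 := by rw [Finset.sum_const, nsmul_eq_mul, Finset.card_univ]

end Generic

/-! ## §2  Generic 12a″ residual: the `Reg`-keyed coercivity row of one generation from pointwise positive definiteness on a compact `K₀ ⊇ Reg` -/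
section GenericZ

variable {F : T4Family} {N : ℕ} [NeZero N] (p : B12.RunParams)

omit [NeZero N] in
/-- **`SU(N)^{bonds}` IS COMPACT, SO A CLOSED SET OF BACKGROUNDS IS A COMPACT `K₀`** (the regular set `{PlaqSmallOn …}` is open — strict inequalities — so one
takes for `K₀` a closed set on which positivity still holds, e.g. the non-strict version of the same plaquette conditions). [folklore] -/
theorem isCompact_of_isClosed_background {K : ℕ} {j : ℕ} {K₀ : Set (GaugeField (F.P K) j (SU N))} (h : IsClosed K₀) : IsCompact K₀ := by
  haveI : CompactSpace (GaugeField (F.P K) j (SU N)) := inferInstanceAs (CompactSpace (PBond (F.P K) j → SU N))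
  exact h.isCompact

omit [NeZero N] in
/-- **★★ THE `Reg`-KEYED COERCIVITY ROW FROM POINTWISE POSITIVE DEFINITENESS**: let `quad_j(Λ′)` of the residual `Z` have the FIBRE FORM
`quad_j(Λ′)(ω) = Qf (π ω) (A_j ω|_{sA})` (`sA = bondsIn j Y`; `π` = ANY reading of the background data into a topological space `X` — the scale-`j` gauge
component `(ω j).1`, or the retained variables of several scales), with `Qf` jointly continuous, 2-homogeneous in the fluctuation variables and positive definite
at every point of a compact `K₀ ⊆ X` that contains `π ω` whenever the scale-`j` background is `Reg`ular ([I]'s positivity of `𝒬_j(U)`, POINTWISE; displayed).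
Then ONE `c > 0` serves all `Reg` backgrounds: `c·Σ_{b∈sA} ‖A_j(b)‖² ≤ quad_j(Λ′)(ω)` — the hypothesis `hcoer` of the sibling's
`afibre_dominated_on_support_of_coercive_on_regular`. [cite: Balaban1987RG1, (2.11) p.267 (shape); Balaban1988Convergent, (2.21) p.258, (2.10) p.256] -/
theorem coercive_on_regular_of_posDef (Z : TkResidualW F N (FluctV N) p.K) (j : ℕ) (Λ' Y : Set (Site (F.P p.K) 0))
    (Reg : GaugeField (F.P p.K) j (SU N) → Prop) {X : Type*} [TopologicalSpace X] (π : MultiCfg (F.P p.K) (SU N) (FluctV N) → X)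
    {K₀ : Set X} (hK : IsCompact K₀) (hRegK : ∀ ω : MultiCfg (F.P p.K) (SU N) (FluctV N), Reg (ω j).1 → π ω ∈ K₀)
    (Qf : X → (↥(Set.toFinite (bondsIn j Y)).toFinset → FluctV N) → ℝ)
    (hcont : Continuous fun q : X × (↥(Set.toFinite (bondsIn j Y)).toFinset → FluctV N) => Qf q.1 q.2)
    (hhom : ∀ (x : X) (t : ℝ) (a : ↥(Set.toFinite (bondsIn j Y)).toFinset → FluctV N), Qf x (t • a) = t ^ 2 * Qf x a)
    (hpos : ∀ x ∈ K₀, ∀ a : ↥(Set.toFinite (bondsIn j Y)).toFinset → FluctV N, a ≠ 0 → 0 < Qf x a)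
    (hval : ∀ ω : MultiCfg (F.P p.K) (SU N) (FluctV N),
      Z.quad j Λ' ω = Qf (π ω) (fun b : ↥(Set.toFinite (bondsIn j Y)).toFinset => (ω j).2 b)) :
    ∃ c : ℝ, 0 < c ∧ ∀ ω : MultiCfg (F.P p.K) (SU N) (FluctV N), Reg (ω j).1 →
      c * ∑ b ∈ (Set.toFinite (bondsIn j Y)).toFinset, ‖(ω j).2 b‖ ^ 2 ≤ Z.quad j Λ' ω := by
  obtain ⟨c₀, hc₀, h⟩ := exists_pos_forall_mul_norm_sq_le_of_isCompact hK Qf hcont hhom hpos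
  set n : ℝ := max 1 (Fintype.card (↥(Set.toFinite (bondsIn j Y)).toFinset) : ℝ) with hn
  have hn1 : 1 ≤ n := le_max_left _ _
  have hn0 : 0 < n := lt_of_lt_of_le one_pos hn1
  refine ⟨c₀ / n, div_pos hc₀ hn0, fun ω hreg => ?_⟩
  set a : ↥(Set.toFinite (bondsIn j Y)).toFinset → FluctV N := fun b => (ω j).2 b with ha
  have hsum : ∑ b ∈ (Set.toFinite (bondsIn j Y)).toFinset, ‖(ω j).2 b‖ ^ 2 = ∑ b : ↥(Set.toFinite (bondsIn j Y)).toFinset, ‖a b‖ ^ 2 :=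
    (Finset.sum_coe_sort _ (fun b => ‖(ω j).2 b‖ ^ 2)).symm
  have hcard : ∑ b : ↥(Set.toFinite (bondsIn j Y)).toFinset, ‖a b‖ ^ 2 ≤ n * ‖a‖ ^ 2 :=
    (sum_norm_sq_le_card_mul_norm_sq a).trans (mul_le_mul_of_nonneg_right (le_max_right _ _) (sq_nonneg _))
  rw [hval ω, hsum]
  calc c₀ / n * ∑ b : ↥(Set.toFinite (bondsIn j Y)).toFinset, ‖a b‖ ^ 2 ≤ c₀ / n * (n * ‖a‖ ^ 2) :=
        mul_le_mul_of_nonneg_left hcard (div_pos hc₀ hn0).le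
    _ = c₀ * ‖a‖ ^ 2 := by field_simp
    _ ≤ Qf (π ω) a := h _ (hRegK _ hreg) a

end GenericZ

/-! ## §3  At the v1.7 `CoPH` record: the per-generation `Reg`-rows of the sibling's ★★★ `integrable_oldBranch_of_coercive_on_regular` -/
section Record

variable {F : T4Family} {N : ℕ} [NeZero N] (θ : Stage13HParams F N) (p : B12.RunParams)

/-- **★★ THE PER-GENERATION `Reg`-KEYED COERCIVITY ROWS OF THE RECORD FROM POINTWISE POSITIVE DEFINITENESS**: for a history `s′`, generation by generation,
the fibre form (through a background reading `π_j` into a topological space `X_j`) + continuity + 2-homogeneity + positive definiteness on a compact `K₀_j` holding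
`π_j ω` at every `Reg_j` background, for `(θ.zhAt p s′).quad j (Λ_{j+1}(init s′))`, give the rows `hcoer` of the sibling's `integrable_oldBranch_of_coercive_on_regular`
∕ bridge `coercive_on_support_of_coercive_on_regular` (A-fibre `sA_j = bondsIn j (Λᶜ_{j+1} ∩ Ω_{j+1})(init s′)`).
[cite: Balaban1987RG1, (2.11) p.267 (shape); Balaban1988Convergent, (2.21) p.258, (2.10) p.256] -/
theorem coercive_rows_on_regular_of_posDef {k : ℕ} (s : SeqOfRecord F θ.ν θ.τ9.M (gOfRecord₁₃ F N θ.toStage13Params p) p.K (k + 1))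
    (Reg : (j : ℕ) → GaugeField (F.P p.K) j (SU N) → Prop) (X : ℕ → Type*) [∀ j, TopologicalSpace (X j)]
    (π : (j : ℕ) → MultiCfg (F.P p.K) (SU N) (FluctV N) → X j) (K₀ : (j : ℕ) → Set (X j))
    (hK : ∀ j, IsCompact (K₀ j)) (hRegK : ∀ j (ω : MultiCfg (F.P p.K) (SU N) (FluctV N)), Reg j (ω j).1 → π j ω ∈ K₀ j)
    (Qf : (j : ℕ) → X j → (↥(Set.toFinite (bondsIn j ((s.init.Λ (j + 1))ᶜ ∩ s.init.Ω (j + 1)))).toFinset → FluctV N) → ℝ)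
    (hcont : ∀ j, Continuous fun q : X j × (↥(Set.toFinite (bondsIn j ((s.init.Λ (j + 1))ᶜ ∩ s.init.Ω (j + 1)))).toFinset → FluctV N) => Qf j q.1 q.2)
    (hhom : ∀ j (x : X j) (t : ℝ) a, Qf j x (t • a) = t ^ 2 * Qf j x a)
    (hpos : ∀ j, ∀ x ∈ K₀ j, ∀ a, a ≠ 0 → 0 < Qf j x a)
    (hval : ∀ j (ω : MultiCfg (F.P p.K) (SU N) (FluctV N)),
      (θ.zhAt p s).quad j (s.init.Λ (j + 1)) ω =
        Qf j (π j ω) (fun b : ↥(Set.toFinite (bondsIn j ((s.init.Λ (j + 1))ᶜ ∩ s.init.Ω (j + 1)))).toFinset => (ω j).2 b)) :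
    ∀ j : ℕ, ∃ c : ℝ, 0 < c ∧ ∀ ω : MultiCfg (F.P p.K) (SU N) (FluctV N), Reg j (ω j).1 →
      c * ∑ b ∈ (Set.toFinite (bondsIn j ((s.init.Λ (j + 1))ᶜ ∩ s.init.Ω (j + 1)))).toFinset, ‖(ω j).2 b‖ ^ 2 ≤
        (θ.zhAt p s).quad j (s.init.Λ (j + 1)) ω := fun j =>
  coercive_on_regular_of_posDef p (θ.zhAt p s) j _ _ (Reg j) (π j) (hK j) (hRegK j) (Qf j) (hcont j) (hhom j) (hpos j) (hval j)

/-- **★★★ THE OLD BRANCH OF RECORD IS `dU_k`-INTEGRABLE FROM POINTWISE POSITIVE DEFINITENESS OF THE VALUE OF `quad` ON COMPACT SETS OF BACKGROUNDS CONTAINING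
THE REGULAR ONES** — the sibling's ★★★ `integrable_oldBranch_of_coercive_on_regular` with its per-generation `Reg`-rows discharged by `coercive_rows_on_regular_of_posDef`:
rows (i) residual laws ∕ unity ∕ measurability; (ii‴) per generation: `ζ0_j((Ω_{j+1})ᶜ) ≠ 0 → Reg_j`, a compact `K₀_j ⊇ Reg_j`, the fibre form of
`quad_j(Λ_{j+1}(init s′))` with `Qf_j` jointly continuous, 2-homogeneous and positive definite on `K₀_j` ([I]'s positivity of `𝒬_j(U)`, POINTWISE; displayed);
(iii) the operand rows. [cite: Balaban1988Convergent, (2.18) p.257, (2.20)–(2.21) p.258, (2.10) p.256, (3.23)–(3.24) p.270; Balaban1987RG1, (2.11) p.267 (shape of the row)] -/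
theorem integrable_oldBranch_of_posDef_on_compact
    (hZ : ∀ (p : B12.RunParams) (n : ℕ) (Ω Λ : ℕ → Set (Site (F.P p.K) 0)), (θ.Zh p n Ω Λ).Laws) (hU : θ.ZhUnity F N) {k : ℕ}
    (s : SeqOfRecord F θ.ν θ.τ9.M (gOfRecord₁₃ F N θ.toStage13Params p) p.K (k + 1)) (S : ℕ → Set (Site (F.P p.K) 0))
    (hζm : ∀ j (Y : Set (Site (F.P p.K) 0)), Measurable ((θ.zhAt p s).ζ0 j Y))
    (hqm : ∀ j (Λ' : Set (Site (F.P p.K) 0)), Measurable ((θ.zhAt p s).quad j Λ'))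
    (Reg : (j : ℕ) → GaugeField (F.P p.K) j (SU N) → Prop)
    (hreg : ∀ (j : ℕ) (ω : MultiCfg (F.P p.K) (SU N) (FluctV N)), (θ.zhAt p s).ζ0 j (s.init.Ω (j + 1))ᶜ ω ≠ 0 → Reg j (ω j).1)
    (X : ℕ → Type*) [∀ j, TopologicalSpace (X j)] (π : (j : ℕ) → MultiCfg (F.P p.K) (SU N) (FluctV N) → X j) (K₀ : (j : ℕ) → Set (X j))
    (hK : ∀ j, IsCompact (K₀ j)) (hRegK : ∀ j (ω : MultiCfg (F.P p.K) (SU N) (FluctV N)), Reg j (ω j).1 → π j ω ∈ K₀ j)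
    (Qf : (j : ℕ) → X j → (↥(Set.toFinite (bondsIn j ((s.init.Λ (j + 1))ᶜ ∩ s.init.Ω (j + 1)))).toFinset → FluctV N) → ℝ)
    (hcont : ∀ j, Continuous fun q : X j × (↥(Set.toFinite (bondsIn j ((s.init.Λ (j + 1))ᶜ ∩ s.init.Ω (j + 1)))).toFinset → FluctV N) => Qf j q.1 q.2)
    (hhom : ∀ j (x : X j) (t : ℝ) a, Qf j x (t • a) = t ^ 2 * Qf j x a)
    (hpos : ∀ j, ∀ x ∈ K₀ j, ∀ a, a ≠ 0 → 0 < Qf j x a)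
    (hval : ∀ j (ω : MultiCfg (F.P p.K) (SU N) (FluctV N)),
      (θ.zhAt p s).quad j (s.init.Λ (j + 1)) ω =
        Qf j (π j ω) (fun b : ↥(Set.toFinite (bondsIn j ((s.init.Λ (j + 1))ᶜ ∩ s.init.Ω (j + 1)))).toFinset => (ω j).2 b))
    {Φ : SFluct (F.P p.K) (FluctV N) → B15DeterminingSets.MSField (F.P p.K) (SU N) → ℝ}
    (hΦm : Measurable fun ω : MultiCfg (F.P p.K) (SU N) (FluctV N) => Φ (S, fun j => (ω j).2) (fun j => (ω j).1))
    (hΦ0 : ∀ a U, 0 ≤ Φ a U) (CΦ : ℝ) (hΦle : ∀ a U, Φ a U ≤ CΦ) :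
    Integrable (fun U₀ : GaugeField (F.P p.K) k (SU N) =>
      tkBranchOfRecord F N (FluctV N) θ.ν θ.τ9.M _ p.K (WtOfRecord₁₃H F N θ p s) s.init S k
        (fun ω => Φ (S, fun j => (ω j).2) (fun j => (ω j).1)) (baseCfg (V := FluctV N) k U₀)) (fieldMeasure (F.P p.K) k (SU N)) :=
  integrable_oldBranch_of_coercive_on_regular θ p hZ hU s S hζm hqm Reg hreg
    (coercive_rows_on_regular_of_posDef θ p s Reg X π K₀ hK hRegK Qf hcont hhom hpos hval) hΦm hΦ0 CΦ hΦle

end Record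

end Summit.QuantumFields.YangMills.Theorems.BalabanUVNodesN11CoerciveOnRegularOfPosDef

end
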